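import Mathlib
import Summits.Ventures.HodgeRepro2.T5SchurOrthogonality

/-!
# T5SchurMathlib — the Schur orthogonality file in Mathlib's vocabulary, and the Haar measure

Tier-5 support (seat p1, cell pub-hodge-repro2), companion of `T5SchurOrthogonality.lean`
(p394792). That file states the Schur orthogonality relations for `π : G →* (V →L[ℂ] V)` with
the cell's own predicates `IsUnitary` / `IsIrreducible`. This file ties them to Mathlib:

* `toRep π` is Mathlib's `Representation ℂ G V` underlying `π` (via `ContRepresentation.ofMonoidHom`);
  `isIrreducible_iff`: the cell's `IsIrreducible π` is `Representation.IsIrreducible (toRep π)`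
  (for `V ≠ 0`), and `nontrivial_of_isIrreducible`;
* `intertwiningMapOf` / `eq_zero_of_isEmpty_equiv`: a continuous intertwiner between two
  inequivalent irreducible representations vanishes — Mathlib's
  `Subsingleton (IntertwiningMap ρ σ)` instance (RepresentationTheory/Irreducible.lean);
* the orthogonality relations restated with Mathlib's hypotheses
  (`schur_orthogonality_of_isIrreducible`, `integral_character_mul_conj_of_isIrreducible`,
  `integral_inner_mul_conj_eq_zero_of_isEmpty_equiv`), and for a compact ABELIAN group the
  one-dimensional form `∫ ‖⟪v, π g u⟫‖² = ‖u‖² ‖v‖²` through Mathlib's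
  `Representation.IsIrreducible.finrank_eq_one_of_isMulCommutative`;
* `haarProb G := Measure.haarMeasure ⊤`, the normalised Haar measure of a compact group
  (a left-invariant probability measure by `haarMeasure_self`), and the relations against it
  (`schur_orthogonality_haar`, `integral_character_mul_conj_haar`) — the printed
  «integration relative to the normalized invariant measure» (Goodman–Wallach §7.3.4, p. 360)
  made concrete. `haarProb` is the multiplicative counterpart of p7's additive
  `T5HaarProbability.haarProb` (a different object: additive compact groups / rings there);
  nothing of p7's file is re-proved or imported.

Honest scope unchanged: compact groups only; nothing about `U(1,1)`, its discrete series,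
formal degrees, or (N).
-/

noncomputable section
/-! ## Bridge to Mathlib's `ContRepresentation` / `Representation.IsIrreducible` and the Haar measure -/

namespace Summit.Ventures.HodgeRepro2.T5SchurMathlib

open Summit.Ventures.HodgeRepro2.T5SchurOrthogonality
open MeasureTheory ComplexConjugate
open scoped InnerProductSpace

variable {G : Type*} [Group G]
variable {V W : Type*} [NormedAddCommGroup V] [InnerProductSpace ℂ V]
  [NormedAddCommGroup W] [InnerProductSpace ℂ W]

/-- Mathlib's `Representation ℂ G V` underlying `π : G →* (V →L[ℂ] V)`
(through `ContRepresentation.ofMonoidHom`). -/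
abbrev toRep (π : G →* (V →L[ℂ] V)) : Representation ℂ G V :=
  (ContRepresentation.ofMonoidHom π).toRepresentation

/-- `toRep π g v = π g v`. -/
theorem toRep_apply (π : G →* (V →L[ℂ] V)) (g : G) (v : V) : toRep π g v = π g v := rfl

variable (π : G →* (V →L[ℂ] V)) (σ : G →* (W →L[ℂ] W))

/-- A `π`-stable submodule is a subrepresentation of `toRep π`. -/
def subrepOfStable (U : Submodule ℂ V) (hU : ∀ g : G, ∀ x ∈ U, π g x ∈ U) :
    Subrepresentation (toRep π) where
  toSubmodule := U
  apply_mem_toSubmodule g _ hv := hU g _ hv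

/-- The cell's `IsIrreducible` is Mathlib's `Representation.IsIrreducible` (for `V ≠ 0`). -/
theorem isIrreducible_iff [Nontrivial V] :
    IsIrreducible π ↔ Representation.IsIrreducible (toRep π) := by
  constructor
  · intro hirr
    haveI : Nontrivial (Subrepresentation (toRep π)) :=
      ⟨⟨⊥, ⊤, fun h => bot_ne_top (α := Submodule ℂ V) (congrArg Subrepresentation.toSubmodule h)⟩⟩
    exact ⟨fun a => by
      rcases hirr a.toSubmodule a.apply_mem_toSubmodule with h | h
      · exact Or.inl (Subrepresentation.toSubmodule_injective h)
      · exact Or.inr (Subrepresentation.toSubmodule_injective h)⟩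
  · intro hirr U hU
    rcases hirr.eq_bot_or_eq_top (subrepOfStable π U hU) with h | h
    · left; exact congrArg Subrepresentation.toSubmodule h
    · right; exact congrArg Subrepresentation.toSubmodule h

/-- Mathlib's irreducibility forces `V ≠ 0`. -/
theorem nontrivial_of_isIrreducible [Representation.IsIrreducible (toRep π)] : Nontrivial V := by
  by_contra h
  rw [not_nontrivial_iff_subsingleton] at h
  have hbt : (⊥ : Subrepresentation (toRep π)) = ⊤ :=
    Subrepresentation.toSubmodule_injective (Subsingleton.elim _ _)
  exact IsSimpleOrder.bot_ne_top hbt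

/-- Every continuous intertwiner `T` (with `π g ∘ T = T ∘ σ g`) is a Mathlib `IntertwiningMap`. -/
def intertwiningMapOf (T : W →L[ℂ] V) (hT : ∀ g, π g ∘L T = T ∘L σ g) :
    Representation.IntertwiningMap (toRep σ) (toRep π) :=
  LinearMap.intertwiningMap_of_isIntertwiningMap (toRep σ) (toRep π) (T : W →ₗ[ℂ] V)
    (fun g v => by
      have := congrArg (fun L : W →L[ℂ] V => L v) (hT g)
      simpa [ContinuousLinearMap.comp_apply] using this.symm)

/-- With Mathlib's hypotheses — `toRep π`, `toRep σ` irreducible and no `Representation.Equiv`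
between `toRep σ` and `toRep π` — every continuous intertwiner vanishes
(Mathlib's `Subsingleton (IntertwiningMap ρ σ)` instance). -/
theorem eq_zero_of_isEmpty_equiv [Representation.IsIrreducible (toRep π)]
    [Representation.IsIrreducible (toRep σ)]
    [IsEmpty (Representation.Equiv (toRep σ) (toRep π))] (T : W →L[ℂ] V)
    (hT : ∀ g, π g ∘L T = T ∘L σ g) : T = 0 := by
  have h := Subsingleton.elim (intertwiningMapOf π σ T hT) 0
  ext v
  have := congrArg (fun f : Representation.IntertwiningMap (toRep σ) (toRep π) => f v) h
  simpa [intertwiningMapOf] using this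

section analytic

variable [TopologicalSpace G] [IsTopologicalGroup G] [MeasurableSpace G] [BorelSpace G]
  [CompactSpace G] [FiniteDimensional ℂ V]

/-- Schur orthogonality with Mathlib's irreducibility hypothesis `Representation.IsIrreducible`. -/
theorem schur_orthogonality_of_isIrreducible (μ : Measure G) [IsProbabilityMeasure μ]
    [μ.IsMulLeftInvariant] (hπ : Continuous π) (hu : IsUnitary π)
    [Representation.IsIrreducible (toRep π)] (u v x y : V) :
    ∫ g, ⟪v, π g u⟫_ℂ * conj ⟪y, π g x⟫_ℂ ∂μ =
      (Module.finrank ℂ V : ℂ)⁻¹ * (⟪x, u⟫_ℂ * ⟪v, y⟫_ℂ) := by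
  haveI : Nontrivial V := nontrivial_of_isIrreducible π
  exact schur_orthogonality π μ hπ hu ((isIrreducible_iff π).mpr inferInstance) u v x y

/-- Character orthogonality with Mathlib's irreducibility hypothesis. -/
theorem integral_character_mul_conj_of_isIrreducible (μ : Measure G) [IsProbabilityMeasure μ]
    [μ.IsMulLeftInvariant] (hπ : Continuous π) (hu : IsUnitary π)
    [Representation.IsIrreducible (toRep π)] :
    ∫ g, character π g * conj (character π g) ∂μ = 1 := by
  haveI : Nontrivial V := nontrivial_of_isIrreducible π
  exact integral_character_mul_conj π μ hπ hu ((isIrreducible_iff π).mpr inferInstance)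

/-- Matrix coefficients of two inequivalent irreducible continuous unitary representations are
orthogonal — the «otherwise 0» case of the printed lemma, with Mathlib's hypotheses
`Representation.IsIrreducible` and `IsEmpty (Representation.Equiv _ _)`. -/
theorem integral_inner_mul_conj_eq_zero_of_isEmpty_equiv (μ : Measure G) [IsProbabilityMeasure μ]
    [μ.IsMulLeftInvariant] (hπ : Continuous π) (hσ : Continuous σ) (hσu : IsUnitary σ)
    [Representation.IsIrreducible (toRep π)] [Representation.IsIrreducible (toRep σ)]
    [IsEmpty (Representation.Equiv (toRep σ) (toRep π))] (u v : V) (x y : W) :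
    ∫ g, ⟪v, π g u⟫_ℂ * conj ⟪y, σ g x⟫_ℂ ∂μ = 0 :=
  integral_inner_mul_conj_eq_zero π σ μ hπ hσ hσu (fun T hT => eq_zero_of_isEmpty_equiv π σ T hT)
    u v x y

/-- A compact ABELIAN group has only one-dimensional irreducible representations
(Mathlib's `finrank_eq_one_of_isMulCommutative`), so for such `G` the relations read
`∫ ‖⟪v, π g u⟫‖² dμ = ‖u‖² ‖v‖²` — the shape used at the compact place of (P3). -/
theorem integral_norm_sq_matrixCoefficient_of_isMulCommutative [IsMulCommutative G]
    (μ : Measure G) [IsProbabilityMeasure μ] [μ.IsMulLeftInvariant] (hπ : Continuous π)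
    (hu : IsUnitary π) [Representation.IsIrreducible (toRep π)] (u v : V) :
    ∫ g, ‖⟪v, π g u⟫_ℂ‖ ^ 2 ∂μ = ‖u‖ ^ 2 * ‖v‖ ^ 2 := by
  haveI : Nontrivial V := nontrivial_of_isIrreducible π
  exact integral_norm_sq_matrixCoefficient_of_finrank_eq_one π μ hπ hu
    ((isIrreducible_iff π).mpr inferInstance)
    (Representation.IsIrreducible.finrank_eq_one_of_isMulCommutative (toRep π)) u v

end analytic

section haar

variable [TopologicalSpace G] [IsTopologicalGroup G] [MeasurableSpace G] [BorelSpace G]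
  [CompactSpace G] [T2Space G]

/-- The normalised Haar measure of a compact group: Mathlib's `haarMeasure ⊤`
(total mass `1` by `haarMeasure_self`). Multiplicative counterpart of p7's additive
`T5HaarProbability.haarProb`; not a re-proof of anything there. -/
def haarProb (G : Type*) [Group G] [TopologicalSpace G] [IsTopologicalGroup G]
    [MeasurableSpace G] [BorelSpace G] [CompactSpace G] [T2Space G] : Measure G :=
  Measure.haarMeasure (⊤ : TopologicalSpace.PositiveCompacts G)

/-- `haarProb G` has total mass `1` (`haarMeasure_self` with `K₀ = ⊤`). -/
instance isProbabilityMeasure_haarProb : IsProbabilityMeasure (haarProb G) := by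
  rw [isProbabilityMeasure_iff, haarProb, ← TopologicalSpace.PositiveCompacts.coe_top]
  exact Measure.haarMeasure_self

/-- `haarProb G` is left-invariant (Mathlib's `isMulLeftInvariant_haarMeasure`). -/
instance isMulLeftInvariant_haarProb : (haarProb G).IsMulLeftInvariant := by
  unfold haarProb; infer_instance

variable [FiniteDimensional ℂ V]

/-- Schur orthogonality against the normalised Haar measure of a compact group. -/
theorem schur_orthogonality_haar (hπ : Continuous π) (hu : IsUnitary π)
    [Representation.IsIrreducible (toRep π)] (u v x y : V) :
    ∫ g, ⟪v, π g u⟫_ℂ * conj ⟪y, π g x⟫_ℂ ∂(haarProb G) =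
      (Module.finrank ℂ V : ℂ)⁻¹ * (⟪x, u⟫_ℂ * ⟪v, y⟫_ℂ) :=
  schur_orthogonality_of_isIrreducible π (haarProb G) hπ hu u v x y

/-- `∫ |χ_π|² = 1` against the normalised Haar measure. -/
theorem integral_character_mul_conj_haar (hπ : Continuous π) (hu : IsUnitary π)
    [Representation.IsIrreducible (toRep π)] :
    ∫ g, character π g * conj (character π g) ∂(haarProb G) = 1 :=
  integral_character_mul_conj_of_isIrreducible π (haarProb G) hπ hu

end haar

end Summit.Ventures.HodgeRepro2.T5SchurMathlib
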